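import Summits.ResolutionOfSingularities.ResolutionOfSingularities.Theorems.MarkedTransferCampaignW46GoodProcrastination
import Summits.ResolutionOfSingularities.ResolutionOfSingularities.Theorems.MarkedTransferCampaignW46PlaneRungI
import HarnessLib

/-!
# [OURS · L1 W4.6 rung (i-h)] OUR PROCEDURE ON SURFACES NEVER STALLS AND TERMINATES FOR ALL CHOICES (cell res-hironaka,
# LADDER-RESOLUTION rung L, D-0089; campaign s46, prover res-L1-s46-pv-1; host route MarkedTransfer,
# `--supports stmt-ResolutionOfSingularities-16155`)

HONEST FRAMING. Nothing here is a statement of H. Hironaka's manuscript (2017-03-23, [Hironaka2017]) and nothing here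
asserts that any statement of it holds. OURS objects and tree geometry only; résumé-free. AI-written; weaker than
expert review. No `sorry`; axioms standard.

## What

Rung (i-h) (`exists_permissibleReaches_resolved`, companion `…GoodProcrastination`) is an EXISTENCE statement: some
finite §2.1-permissible sequence resolves every standard ideal exponent on a surface over a perfect field. This file
states OUR PROCEDURE as a CENTRE RULE and proves the two procedure-style properties the typed procedure lacks on the
plane (negative half p475556):

* the rule — `OurCentre A E D`: EITHER `D` is a GOOD PROCRASTINATION (`CentreGoodProcrastination E D`: a closed point at
  which a singular CURVE of `Sing(E)`, with its reduced structure, is singular) OR every singular curve of `E` is regular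
  (`Regime.singCurvesRegular`) and `D` does not procrastinate (an honest centre: a regular singular curve, or a singular
  point on no singular curve);
* **NO STALL** — `exists_ourStep`: from every unresolved standard surface state a §2.1-permissible step obeying the rule
  exists, and leads to a standard surface state;
* **TERMINATION FOR ALL CHOICES** — `planeOurProcedureTerminates_holds`: there is NO infinite §2.1-permissible sequence on
  surfaces all of whose centres obey the rule (`PlaneOurProcedureTerminates`). Proof: if some stage has all its singular
  curves regular, the class persists (`singCurvesRegular_transform`, p535455) and the tail is an infinite honest sequence,
  impossible by rung (i-b) (p526033); otherwise every step is a good procrastination and the total `δ`-invariant of the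
  prime divisors of `V(J)` (rung (ii-2)'s `familyDelta`, res-L1-s46-pv-11) drops forever in `ℕ∞` — well-founded.

So on surfaces OUR procedure — the typed centre rule with procrastination restricted to GOOD procrastinations — runs from
any standard state, never stalls before `Sing = ∅`, and always stops. Replaces the role of Th. 16.13 p.87 l.26–28
(«repeatedly but finitely many times … resolved») on surfaces by OUR procedure; says nothing about the manuscript's.

## References

* J. Kollár, Lectures on Resolution of Singularities (2007), §1.4, Thm. 1.47. [Kollar2007]
* R. Hartshorne, Algebraic Geometry (1977), Ch. V Prop. 3.8, Thm. 3.9. [Hartshorne1977]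
* H. Hironaka, ms. 2017-03-23, §2.1 p.4 l.34–39, Th. 16.6 p.84 l.4–9, Th. 16.13 p.87 l.26–28 — scope only, under
  adjudication, not cited as fact. [Hironaka2017]
-/

noncomputable section

set_option linter.dupNamespace false -- mandated namespace of this single-conjunct summit

open CategoryTheory AlgebraicGeometry TopologicalSpace IsLocalRing

namespace Summit.ResolutionOfSingularities.ResolutionOfSingularities.Theorems

namespace CampaignW46

open Literature.AlgebraicGeometry.Resolution
open Literature.AlgebraicGeometry.Hironaka2017.S02Preliminaries
open Literature.AlgebraicGeometry.Hironaka2017.Datum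
open Scheme.IdealSheafData

universe u

variable {p : ℕ} [Fact p.Prime] {K : Type u} [Field K] [CharP K p]

/-! ## Two integral closed subschemes with the same generic point -/

/-- **Two closed immersions of integral schemes with the same image have the same points and the same singular points**:
if `i₁ : C₁ ↪ Z`, `i₂ : C₂ ↪ Z` are closed immersions of integral schemes with `i₁(η_{C₁}) = i₂(η_{C₂})`, then every point
`c₁` of `C₁` corresponds to a point `c₂` of `C₂` over the same point of `Z`, regular iff `c₁` is (both kernels are the
prime-divisor ideal of the common generic point, so `C₁ ≅ C₂` over `Z`). [cite: StacksProject, Tag 01J3] -/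
theorem exists_point_of_same_image {Z C₁ C₂ : Scheme.{u}} [IsIntegral C₁] [IsIntegral C₂] (i₁ : C₁ ⟶ Z) (i₂ : C₂ ⟶ Z)
    [IsClosedImmersion i₁] [IsClosedImmersion i₂] (hgen : i₁ (genericPoint C₁) = i₂ (genericPoint C₂)) (c₁ : C₁) :
    ∃ c₂ : C₂, i₂ c₂ = i₁ c₁ ∧ (c₂ ∈ Scheme.regularLocus C₂ ↔ c₁ ∈ Scheme.regularLocus C₁) := by
  have hker : i₂.ker = i₁.ker := by
    rw [ker_eq_primeDivisorIdeal_of_isIntegral i₁, ker_eq_primeDivisorIdeal_of_isIntegral i₂, hgen]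
  set e := IsClosedImmersion.lift i₂ i₁ hker.le with he
  haveI : IsIso e := IsClosedImmersion.isIso_lift i₂ i₁ hker
  have hfac : e ≫ i₂ = i₁ := IsClosedImmersion.lift_fac i₂ i₁ hker.le
  refine ⟨e c₁, by rw [← Scheme.Hom.comp_apply, hfac], ?_⟩
  haveI : IsIso (e.stalkMap c₁) := inferInstance
  let f := (asIso (e.stalkMap c₁)).commRingCatIsoToRingEquiv
  constructor
  · intro h
    haveI : IsRegularLocalRing (C₂.presheaf.stalk (e c₁)) := h
    exact IsRegularLocalRing.of_ringEquiv f
  · intro h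
    haveI : IsRegularLocalRing (C₁.presheaf.stalk c₁) := h
    exact IsRegularLocalRing.of_ringEquiv f.symm

/-! ## The centre rule of OUR procedure -/

/-- [OURS · L1 W4.6 rung (i-h)] NOT a statement of the manuscript. **The centre `D` is a GOOD PROCRASTINATION for `E`**:
`D = {ξ}` for a point `ξ` at which a singular CURVE of `E` — the closure of a non-closed point `η ∈ Sing(E)`, with its
reduced structure `V(𝓘_{cl η})` — is SINGULAR (`ξ` is the image of a non-regular point of that integral scheme).
[folklore] -/
def CentreGoodProcrastination {Z : Scheme.{u}} (E : IdealExponent Z) (D : Closeds Z) : Prop :=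
  ∃ ξ η : Z, (D : Set Z) = {ξ} ∧ η ∈ E.sing ∧ ¬ IsClosed ({η} : Set Z) ∧
    haveI : IsIntegral (primeDivisorIdeal η).subscheme :=
      isIntegral_subscheme_vanishingIdeal _ isIrreducible_singleton.closure
    ∃ c : (primeDivisorIdeal η).subscheme,
      (primeDivisorIdeal η).subschemeι c = ξ ∧ c ∉ Scheme.regularLocus (primeDivisorIdeal η).subscheme

/-- A good procrastination procrastinates (honest labelling: `η ≠ ξ` specialises to `ξ`). [folklore] -/
theorem CentreGoodProcrastination.centreProcrastinates {Z : Scheme.{u}} {E : IdealExponent Z} {D : Closeds Z}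
    (h : CentreGoodProcrastination E D) : CentreProcrastinates E D := by
  obtain ⟨ξ, η, hD, hηS, hncl, c, hc, -⟩ := h
  have hmem : ξ ∈ closure ({η} : Set Z) := by
    rw [← hc, ← coe_support_primeDivisorIdeal, ← Scheme.IdealSheafData.range_subschemeι]
    exact ⟨c, rfl⟩
  refine ⟨ξ, η, hD, hηS, ?_, specializes_iff_mem_closure.mpr hmem⟩
  rintro rfl
  have hξcl : IsClosed ({η} : Set Z) := by
    have : IsClosed (D : Set Z) := D.isClosed
    rwa [hD] at this
  exact hncl hξcl

/-- In the class «singular curves regular» no centre is a good procrastination. [folklore] -/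
theorem not_centreGoodProcrastination_of_singCurvesRegular (A : AmbientDatum p K) {E : IdealExponent A.Z}
    (hP : Regime.singCurvesRegular A E) (D : Closeds A.Z) : ¬ CentreGoodProcrastination E D := by
  rintro ⟨ξ, η, -, hηS, hncl, c, -, hc⟩
  exact hc (hP η hηS hncl c)

/-- [OURS · L1 W4.6 rung (i-h)] NOT a statement of the manuscript. **THE CENTRE RULE OF OUR PROCEDURE on surfaces**: the
centre is a good procrastination, or — once every singular curve is regular — an honest (non-procrastinating) centre.
[folklore] -/
def OurCentre (A : AmbientDatum p K) (E : IdealExponent A.Z) (D : Closeds A.Z) : Prop :=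
  CentreGoodProcrastination E D ∨ (Regime.singCurvesRegular A E ∧ ¬ CentreProcrastinates E D)

/-! ## No stall -/

/-- [OURS · L1 W4.6 rung (i-h)] NOT a statement of the manuscript. **OUR PROCEDURE NEVER STALLS.** Over a perfect field:
from every standard ideal exponent `E` on an ambient datum of dimension `≤ 2` with `Sing(E) ≠ ∅` there is a
§2.1-permissible blow-up whose centre obeys OUR rule (`OurCentre`), over the same field, to an ambient datum of dimension
`≤ 2` on which the transform is standard. [folklore] -/
theorem exists_ourStep [PerfectField K] (A : AmbientDatum p K) (E : IdealExponent A.Z) (hE : E.IsStandard)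
    (hdimZ : topologicalKrullDim A.Z ≤ 2) (hne : E.sing.Nonempty) :
    ∃ (A' : AmbientDatum p K) (D : Closeds A.Z) (π : A'.Z ⟶ A.Z),
      E.IsPermissibleCentre A.hom D ∧ OurCentre A E D ∧ A'.hom = π ≫ A.hom ∧ IsBlowup π (vanishingIdeal D) ∧
        (E.transform π D).IsStandard ∧ topologicalKrullDim A'.Z ≤ 2 := by
  classical
  by_cases hP : Regime.singCurvesRegular A E
  · -- honest step (rung (i-f))
    obtain ⟨A', D, π, hD, hnp, hhom, hπ, hst, hdim⟩ := exists_honestStep A E hE hne hP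
    exact ⟨A', D, π, hD, Or.inr ⟨hP, hnp⟩, hhom, hπ, hst, hdim 2 hdimZ⟩
  · -- a singular curve singular at some point: a good procrastination there
    obtain ⟨η, hηS, hncl, hnreg⟩ : ∃ η ∈ E.sing, ¬ IsClosed ({η} : Set A.Z) ∧
        ¬ Scheme.IsRegular (primeDivisorIdeal η).subscheme := by
      by_contra h
      push Not at h
      exact hP fun η hηS hncl => h η hηS hncl
    haveI hint : IsIntegral (primeDivisorIdeal η).subscheme :=
      isIntegral_subscheme_vanishingIdeal _ isIrreducible_singleton.closure
    obtain ⟨c, hc⟩ : ∃ c : (primeDivisorIdeal η).subscheme, c ∉ Scheme.regularLocus _ := not_forall.mp hnreg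
    -- read `c` on a member of a curve family
    obtain ⟨n, ι, hι, ζ, C, i, hfam, -, hrange, -⟩ := exists_hasCurveFamily A hE hdimZ
    have hηdiv : η ∈ divisorialPoints E.J := mem_divisorialPoints_of_mem_sing A hE hdimZ hηS hncl
    rw [← hrange] at hηdiv
    obtain ⟨k₀, hk₀⟩ := hηdiv
    haveI := (hfam k₀).1
    haveI := (hfam k₀).2.1
    haveI := (hfam k₀).2.2.1
    haveI : IsLocallyNoetherian A.Z := ambient_isLocallyNoetherian A
    have hgen : (primeDivisorIdeal η).subschemeι (genericPoint _) = i k₀ (genericPoint (C k₀)) := by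
      rw [subschemeι_genericPoint_primeDivisorIdeal, (hfam k₀).2.2.2.2.2, hk₀]
    obtain ⟨c₀, hc₀ξ, hc₀reg⟩ := exists_point_of_same_image _ (i k₀) hgen c
    have hc₀ : c₀ ∉ Scheme.regularLocus (C k₀) := fun h => hc (hc₀reg.mp h)
    -- the centre `ξ = i k₀ c₀ = ι c`, a closed point of the singular curve `closure {η} ⊆ Sing(E)`
    have hc₀cl : IsClosed ({c₀} : Set (C k₀)) :=
      isClosed_singleton_of_not_mem_regularLocus_of_dim_le_one (hfam k₀).2.2.2.1 (hfam k₀).2.2.2.2.1 hc₀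
    have hξcl : IsClosed ({i k₀ c₀} : Set A.Z) := by
      rw [← Set.image_singleton]
      exact (i k₀).isClosedEmbedding.isClosedMap _ hc₀cl
    have hξmem : i k₀ c₀ ∈ closure ({η} : Set A.Z) := by
      rw [hc₀ξ, ← coe_support_primeDivisorIdeal, ← Scheme.IdealSheafData.range_subschemeι]
      exact ⟨c, rfl⟩
    have hξS : i k₀ c₀ ∈ E.sing :=
      (A.isClosed_sing E).closure_subset_iff.mpr (Set.singleton_subset_iff.mpr hηS) hξmem
    have hD : E.IsPermissibleCentre A.hom ⟨{i k₀ c₀}, hξcl⟩ :=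
      Literature.AlgebraicGeometry.Hironaka2017.S16Proof.isPermissibleCentre_point A E hξcl hξS
    obtain ⟨A', π, hhom, hπ, hst, hdim⟩ := exists_ambientBlowup A ⟨{i k₀ c₀}, hξcl⟩
      (isRegular_subscheme_vanishingIdeal_singleton hξcl) (ne_univ_of_subset_sing A hE hD.subset_sing)
    exact ⟨A', _, π, hD, Or.inl ⟨i k₀ c₀, η, rfl, hηS, hncl, c, hc₀ξ.symm, hc⟩, hhom, hπ, hst E hE, hdim 2 hdimZ⟩

/-! ## The measure drops under every good procrastination -/

/-- **`Δ` drops under a good procrastination.** For a standard `E` on an ambient datum of dimension `≤ 2`, a good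
procrastination `D = {ξ}` and a blowing up `π` along `𝓘_D`: every curve family of `V(J)` of total `δ`-invariant `n`
yields a curve family of `V(J′)`, `J′` the ideal of the transform (Def. 2.1), of total `δ`-invariant `< n` (rung
(ii-2)'s `exists_family_pointBlowup`, res-L1-s46-pv-11; the strictness at the member through `ξ`, read on that member
by `exists_point_of_same_image`). [cite: Kollar2007, §1.4] -/
theorem exists_hasCurveFamily_transform_lt (A A' : AmbientDatum p K) (E : IdealExponent A.Z) (hE : E.IsStandard)
    (hdimZ : topologicalKrullDim A.Z ≤ 2) {D : Closeds A.Z} (hgood : CentreGoodProcrastination E D)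
    {π : A'.Z ⟶ A.Z} (hπ : IsBlowup π (vanishingIdeal D)) {n : ℕ∞} (hF : HasCurveFamily A.Z E.J n) :
    ∃ n', n' < n ∧ HasCurveFamily A'.Z (E.transform π D).J n' := by
  classical
  haveI := ambient_isIntegral A
  haveI := AmbientDatum.isNoetherian_ambient A
  have hZreg : Scheme.IsRegular A.Z := ambient_isRegular A
  have hXq : Scheme.IsQuasiExcellent A.Z := (AmbientDatum.isExcellent_Z A).isQuasiExcellent
  obtain ⟨ξ, η, hDξ, hηS, hncl, c, hcξ, hc⟩ := hgood
  obtain ⟨ι, hι, ζ, C, i, hfam, hζinj, hrange, hn⟩ := hF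
  haveI hint : ∀ k, IsIntegral (C k) := fun k => (hfam k).2.1
  -- `η = ζ k₀`; read the singular point `c` over `ξ` on the member `C k₀`
  have hηdiv : η ∈ divisorialPoints E.J := mem_divisorialPoints_of_mem_sing A hE hdimZ hηS hncl
  have hηdiv' := hηdiv
  rw [← hrange] at hηdiv'
  obtain ⟨k₀, hk₀⟩ := hηdiv'
  haveI := (hfam k₀).1
  haveI : IsIntegral (primeDivisorIdeal η).subscheme :=
    isIntegral_subscheme_vanishingIdeal _ isIrreducible_singleton.closure
  have hgen : (primeDivisorIdeal η).subschemeι (genericPoint _) = i k₀ (genericPoint (C k₀)) := by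
    rw [subschemeι_genericPoint_primeDivisorIdeal, (hfam k₀).2.2.2.2.2, hk₀]
  obtain ⟨c₀, hc₀ξ, hc₀reg⟩ := exists_point_of_same_image _ (i k₀) hgen c
  have hc₀ : c₀ ∉ Scheme.regularLocus (C k₀) := fun h => hc (hc₀reg.mp h)
  have hic₀ : i k₀ c₀ = ξ := hc₀ξ.trans hcξ
  -- the centre is the closed point `ξ` of the singular curve `closure {η} ⊆ Sing(E)`, not a prime divisor of `V(J)`
  have hξcl : IsClosed ({ξ} : Set A.Z) := by rw [← hDξ]; exact D.isClosed
  obtain rfl : D = ⟨{ξ}, hξcl⟩ := Closeds.ext hDξ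
  have hξmem : ξ ∈ closure ({η} : Set A.Z) := by
    rw [← hcξ, ← coe_support_primeDivisorIdeal, ← Scheme.IdealSheafData.range_subschemeι]
    exact ⟨c, rfl⟩
  have hξS : ξ ∈ E.sing := (A.isClosed_sing E).closure_subset_iff.mpr (Set.singleton_subset_iff.mpr hηS) hξmem
  have hξne : ({ξ} : Set A.Z) ≠ Set.univ := ne_univ_of_subset_sing A hE (Set.singleton_subset_iff.mpr hξS)
  have hηgen : η ≠ genericPoint A.Z := fun h => not_mem_support_genericPoint hE.1 (h ▸ hηdiv.1)
  have hξdiv : ξ ∉ divisorialPoints E.J := fun h =>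
    coheight_ne_one_of_isClosed_of_mem_closure hηgen hncl hξcl hξmem h.2
  -- the new family (rung (ii-2) bookkeeping), `Δ` drops at `k₀`
  obtain ⟨ζ', C', i', hinj', hrange', hfam', -, -, hδ, hδE⟩ :=
    exists_family_pointBlowup hZreg hXq hdimZ hξcl hξne hπ E.J E.b hξdiv ζ C i hζinj hrange hfam
  haveI hint' : ∀ k', IsIntegral (C' k') := fun k' => (hfam' k').2.1
  haveI hN : ∀ k, IsNoetherian (C k) := fun k => (hfam k).2.2.1
  refine ⟨@familyDelta _ C' (fun k' => (hfam' k').2.1), ?_, _, inferInstance, ζ', C', i', hfam', hinj', hrange', rfl⟩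
  rw [← hn]
  exact familyDelta_lt_of_inl_le C C' (fun k => finsum_pointDelta_ne_top (hfam k).2.2.2.1 (hfam k).2.2.2.2.1)
    (fun k => (hδ k (hint' _) (hint k)).1) ⟨k₀, (hδ k₀ (hint' _) (hint k₀)).2 ⟨c₀, hic₀, hc₀⟩⟩
    fun s => hδE s (hint' _)

/-! ## Termination for all choices -/

/-- [OURS · L1 W4.6 rung (i-h)] NOT a statement of the manuscript. **«OUR PROCEDURE TERMINATES ON SURFACES, WHATEVER THE
CHOICES»**: there is NO infinite §2.1-permissible sequence (standard ideal exponents, permissible centres, blow-ups,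
transforms of Def. 2.1) all of whose stages have dimension `≤ 2` and all of whose centres obey OUR rule (`OurCentre`: a
good procrastination, or an honest centre once every singular curve is regular). The analogue for OUR procedure of the
role of the termination clause of Th. 16.13 p.87 l.26–28; compare rung (i-b) (`PlaneNonProcrastinatingTerminates`,
p515754/p526033) and the negative half (p475556) for the typed procedure. [folklore] -/
def PlaneOurProcedureTerminates (p : ℕ) [Fact p.Prime] (K : Type u) [Field K] [CharP K p] : Prop :=
  ∀ r : PermissibleRun p K, (∀ k, Regime.dimLE 2 (r.A k) (r.E k)) → (∀ k, OurCentre (r.A k) (r.E k) (r.D k)) → False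

/-- Along a sequence obeying OUR rule, the class «singular curves regular» persists from any stage on, and from there
every step is honest. [folklore] -/
theorem PermissibleRun.singCurvesRegular_add (r : PermissibleRun p K) (hdim : ∀ k, Regime.dimLE 2 (r.A k) (r.E k))
    (hour : ∀ k, OurCentre (r.A k) (r.E k) (r.D k)) {k : ℕ} (hk : Regime.singCurvesRegular (r.A k) (r.E k)) (m : ℕ) :
    Regime.singCurvesRegular (r.A (k + m)) (r.E (k + m)) ∧ ¬ CentreProcrastinates (r.E (k + m)) (r.D (k + m)) := by
  induction m with
  | zero =>
    refine ⟨hk, ?_⟩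
    rcases hour k with hgood | ⟨-, hnp⟩
    · exact absurd hgood (not_centreGoodProcrastination_of_singCurvesRegular _ hk _)
    · exact hnp
  | succ m ih =>
    obtain ⟨hP, hnp⟩ := ih
    have hP' : Regime.singCurvesRegular (r.A (k + m + 1)) (r.E (k + m + 1)) := by
      rw [r.E_succ (k + m)]
      exact singCurvesRegular_transform (r.A (k + m)) (r.A (k + m + 1)) (r.E (k + m)) (r.standard _) (hdim _) hP
        (r.permissible _) hnp (r.blowup _)
    refine ⟨hP', ?_⟩
    rcases hour (k + m + 1) with hgood | ⟨-, hnp'⟩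
    · exact absurd hgood (not_centreGoodProcrastination_of_singCurvesRegular _ hP' _)
    · exact hnp'

/-- [OURS · L1 W4.6 rung (i-h)] NOT a statement of the manuscript. **OUR PROCEDURE TERMINATES ON SURFACES FOR ALL
CHOICES** (perfect `K : Type`). If some stage has all its singular curves regular, the class persists and the tail is an
infinite honest sequence on surfaces — none exists (rung (i-b), `planeNonProcrastinatingTerminates_holds`); otherwise
every step is a good procrastination and `Δ` (total `δ` of the prime divisors of `V(J)`) would descend forever in `ℕ∞`.
[cite: Kollar2007, §1.4] -/
theorem planeOurProcedureTerminates_holds (p : ℕ) [Fact p.Prime] (K : Type) [Field K] [CharP K p] [PerfectField K] :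
    PlaneOurProcedureTerminates p K := by
  intro r hdim hour
  by_cases hA : ∃ k, Regime.singCurvesRegular (r.A k) (r.E k)
  · -- an honest tail: rung (i-b)
    obtain ⟨k, hk⟩ := hA
    refine planeNonProcrastinatingTerminates_holds p K (r.drop k)
      (fun m => (PermissibleRun.drop_regime_iff (Regime.dimLE 2) r k m).mpr (hdim (m + k))) fun m => ?_
    rw [PermissibleRun.drop_procrastinates_iff, show m + k = k + m from Nat.add_comm m k,
      PermissibleRun.procrastinates_iff]
    exact (r.singCurvesRegular_add hdim hour hk m).2
  · -- good procrastinations forever: `Δ` descends in `ℕ∞`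
    push Not at hA
    have hgood : ∀ k, CentreGoodProcrastination (r.E k) (r.D k) := fun k =>
      (hour k).resolve_right fun h => hA k h.1
    have key : ∀ (n : ℕ∞) (k : ℕ), ¬ HasCurveFamily (r.A k).Z (r.E k).J n := by
      intro n
      induction n using WellFoundedLT.induction with
      | _ n ih =>
      intro k hF
      obtain ⟨n', hlt, hF'⟩ := exists_hasCurveFamily_transform_lt (r.A k) (r.A (k + 1)) (r.E k) (r.standard k)
        (hdim k) (hgood k) (r.blowup k) hF
      rw [← r.E_succ k] at hF'
      exact ih n' hlt (k + 1) hF'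
    obtain ⟨n₀, hF₀⟩ := exists_hasCurveFamily (r.A 0) (r.standard 0) (hdim 0)
    exact key n₀ 0 hF₀

/-- [OURS · L1 W4.6 rung (i-h)] NOT a statement of the manuscript. **Summary: OUR PROCEDURE RESOLVES, RUN ANYHOW.** Every
finite sequence of OUR steps from a standard surface state over a perfect field either ends at a resolved state or can
be continued by an OUR step (`exists_ourStep`), and no infinite sequence of OUR steps exists
(`planeOurProcedureTerminates_holds`); in particular a resolved state is reached (`exists_permissibleReaches_resolved`,
p539260). This conjunction is recorded here by name. [folklore] -/
theorem ourProcedure_noStall_and_terminates (p : ℕ) [Fact p.Prime] (K : Type) [Field K] [CharP K p] [PerfectField K] :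
    (∀ (A : AmbientDatum p K) (E : IdealExponent A.Z), E.IsStandard → Regime.dimLE 2 A E → E.sing.Nonempty →
      ∃ (A' : AmbientDatum p K) (D : Closeds A.Z) (π : A'.Z ⟶ A.Z),
        E.IsPermissibleCentre A.hom D ∧ OurCentre A E D ∧ A'.hom = π ≫ A.hom ∧ IsBlowup π (vanishingIdeal D) ∧
          (E.transform π D).IsStandard ∧ Regime.dimLE 2 A' (E.transform π D)) ∧
    PlaneOurProcedureTerminates p K :=
  ⟨fun A E hE hdim hne => exists_ourStep A E hE hdim hne, planeOurProcedureTerminates_holds p K⟩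

end CampaignW46

end Summit.ResolutionOfSingularities.ResolutionOfSingularities.Theorems

end
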